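import Literature.NumberTheory.EllipticCurves.Kato2004.LocPKummerLog
import Literature.NumberTheory.EllipticCurves.KummerSelmerStructure
import Literature.NumberTheory.EllipticCurves.WeilPairingLevelDescent
import Literature.NumberTheory.EllipticCurves.GaloisActionProofs
import Literature.NumberTheory.GaloisCohomology.PairingTateDual
import Literature.NumberTheory.GaloisCohomology.PoitouTate
import HarnessLib

/-!
# The local index at `p` of a global class `y₀ ∈ H¹(ℚ, T_pW)` — Kato's `ν` of Prop. 14.16 (2)
# (`[H¹(ℚ_p,T)/H¹_f(ℚ_p,T) : z]`, Lemma 14.18) in the tree's two finite-level currencies: the KUMMER form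
# `ZetaLineIndexAt` and the PAIRING form `ZetaLineOrthIndexAt`

Topic `NumberTheory/EllipticCurves`, sub-directory `Kato2004` (namespace = path).  Seat `bsd-potss-rkm`
(generation 21, cell `bsd-potss`; crux M = item stmt-BirchSwinnertonDyer-19196 `ReducibleKatoMember` of the
routes K9 / K8-t′), on the planner's re-key request (TARGET R265, T1).  DEFINITIONS ONLY (two `Prop`-valued
predicates with parameters and an unfolding lemma): nothing is asserted, no named fact is minted, no
instance / notation; nothing about BSD is proved.

## The notion (Kato, Astérisque 295, Prop. 14.16 (2) and Lemma 14.18; C.-H. Kim, AJM 148 §3.2.3)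

In Kato's proof of Prop. 14.16 (2) (p. 244) the count of the Selmer group `S(T)` of `T = T_pW` against a
class `z ∈ H¹(ℤ[1/p], T)` involves the LOCAL index `[H¹(ℚ_p, T)/H¹_f(ℚ_p, T) : z]` (the number `ν`), which
Lemma 14.18 / Kim §3.2.3 evaluate through the dual exponential map: for the bottom class `y₀` of a
zeta-element family, `[H¹_{/f}(ℚ_p, T_pW) : ℤ_p ȳ₀] = p^e`,
`e = ord_p(L(W,1)/Ω) + v_p(λ(0)) + ord_p #W(ℚ_p)[p^∞] − v_p(c_p)` at an additive prime `p` (Kim: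
`exp*_ω(H¹(ℚ_p, T_pW)) = c_p · p^{−ord_p #W(ℚ_p)[p^∞]} · ℤ_p`).  Since `H¹_f(ℚ_p, T_pW)` is the image of
the local Kummer map (Bloch–Kato Ex. 3.11) and `H¹(ℚ_p, T_pW) = lim← H¹(ℚ_p, W[p^k])`, the statement
«`[H¹_{/f}(ℚ_p, T_pW) : ℤ_p ȳ₀] = p^e`» has the FINITE-LEVEL form typed here, with no `B_dR`:

* `ZetaLineIndexAt W p y₀ e` (KUMMER form, cell `bsd-addord`'s currency `locModPk` /
  `kummerLocalConditionAt` of `LocPKummerLog.lean` / `KummerSelmerStructure.lean`): for every level `p^k`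
  and every integer `c`, «`loc_p(c · y₀) mod p^k` is a local Kummer class» iff `p^k ∣ c · p^e`;
* `ZetaLineOrthIndexAt W p y₀ e` (PAIRING form, the currency of the crux-M ledger
  `Theorems/KatoDescentPotSupersingularASide*`: local Tate pairing `localTatePairingZMod` of a Poitou–Tate
  family `inv` at level `p^j p^k`, the Weil pairing `ε` of level `p^j p^k` DESCENDED to `W[p^k]`
  (`descendHom`), the dual map `pairingDualIntertwining`, the local Kummer condition
  `kummerSelmerStructure … (Sum.inr (primePlace p))`): for all large `k`, every `j`, every perfect family
  `inv`, every non-degenerate alternating `Γ_ℚ`-equivariant `ε` and every integer `c`, IF the class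
  `loc_p (desc_ε^♭)_* ι′_* red_{p^k}(c · y₀) ∈ H¹(ℚ_p, W[p^k]^D)` is orthogonal to every local Kummer class THEN
  `p^k ∣ c · p^e` — ONE direction only (a LOWER bound `p^{k−e}` for the index of the zeta line's local
  image), which is all the ledger consumes and is weaker than the printed equality.

Under local Tate duality (the local Kummer condition is its own annihilator for the descended Weil
pairing — Milne *ADT* I Cor. 3.4 / Poonen–Rains Prop. 4.10 at finite level; the tree's
`X11b/KummerStructureDuality` for the un-descended pairing) the pairing form is the `→` half of the
Kummer form; that bridge is NOT proved here (the pairing form is visibly monotone in `e`).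

References: K. Kato, Astérisque 295 (2004), Prop. 14.16 (2) (p. 244) and its proof (p. 245), §14.17,
Lemma 14.18 (pp. 247–248) [Kato2004Asterisque]; C.-H. Kim, Amer. J. Math. 148 (2026) §3.2.3
[Kim2022StructureSelmer]; S. Bloch, K. Kato (1990) Def. 3.10, Ex. 3.11, Prop. 3.8 [BlochKato1990];
J. S. Milne, *ADT* (2006) I Cor. 2.3, Cor. 3.4, §6 [MilneADT2006]; B. Poonen, E. Rains (2012) Prop. 4.10
[PoonenRains2012]; tree: `Kato2004/LocPKummerLog.lean`, `KummerSelmerStructure.lean`,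
`WeilPairingLevelDescent.lean`, `GaloisCohomology/PairingTateDual.lean`, `GaloisCohomology/PoitouTate.lean`.
-/

noncomputable section

open scoped Classical NumberField
open Field IsDedekindDomain CategoryTheory
open Literature.NumberTheory.GaloisRepresentations Literature.NumberTheory.GaloisCohomology
open Literature.NumberTheory.GaloisRepresentations.DiscreteGaloisModule
  (localTatePairingZMod pairingDualIntertwining)
open Literature.NumberTheory.EllipticCurves Literature.NumberTheory.EllipticCurves.Kato2004
open Literature.NumberTheory.EllipticCurves.Kato2004.EulerSystemValues
open WeierstrassCurve (geomTorsion)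

namespace Literature.NumberTheory.EllipticCurves.Kato2004

section Index

variable (W : WeierstrassCurve ℚ) [W.IsElliptic] (p : ℕ) [Fact p.Prime]
  [ContinuousSMul ℤ_[p] (W.tateModule p)]

/-- **`ZetaLineIndexAt W p y₀ e` — the local index of `y₀ ∈ H¹(ℚ, T_pW)` at `p` is `p^e`, KUMMER FORM**
(Kato's `ν`-index `[H¹(ℚ_p,T)/H¹_f(ℚ_p,T) : ȳ₀] = p^e` of Prop. 14.16 (2) / Lemma 14.18, in the finite-level
currency of `LocPKummerLog.lean`): at every level `p^k` and for every integer `c`, the reduction modulo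
`p^k` of `loc_p(c · y₀)` (`locModPk`) lies in the local Kummer condition
`ker (H¹(ℚ_p, W[p^k]) → H¹(ℚ_p, W))` (`kummerLocalConditionAt`, the image of `W(ℚ_p)/p^k`) iff
`p^k ∣ c · p^e`.  (Faithful because `H¹_f(ℚ_p, T_pW) = W(ℚ_p) ⊗ ℤ_p` is the Kummer image, Bloch–Kato Ex. 3.11,
contains the torsion of `H¹(ℚ_p, T_pW)`, and `H¹(ℚ_p,T)/H¹_f ≅ ℤ_p`.)  A `Prop`; nothing asserted.
[cite: Kato2004Asterisque, Prop. 14.16 (2) (p. 244) and Lemma 14.18 (pp. 247–248)]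
[cite: Kim2022StructureSelmer, §3.2.3 display before Thm. 3.7 (PDF p. 16)] [cite: BlochKato1990, Def. 3.10 and Ex. 3.11] -/
def ZetaLineIndexAt (y₀ : H1 (tateRep W p) ⊤) (e : ℕ) : Prop :=
  ∀ (k : ℕ) (c : ℤ),
    locModPk W p k (c • y₀) ∈ W.kummerLocalConditionAt ((p : ℤ) ^ k) ((primePlace p).adicCompletion ℚ) ↔
      ((p ^ k : ℕ) : ℤ) ∣ c * p ^ e

/-- Unfolding `ZetaLineIndexAt`. [cite: Kato2004Asterisque, Lemma 14.18 (pp. 247–248)] -/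
theorem zetaLineIndexAt_iff (y₀ : H1 (tateRep W p) ⊤) (e : ℕ) :
    ZetaLineIndexAt W p y₀ e ↔ ∀ (k : ℕ) (c : ℤ),
      locModPk W p k (c • y₀) ∈ W.kummerLocalConditionAt ((p : ℤ) ^ k) ((primePlace p).adicCompletion ℚ) ↔
        ((p ^ k : ℕ) : ℤ) ∣ c * p ^ e :=
  Iff.rfl

/-- **`ZetaLineOrthIndexAt W p y₀ e` — the local index of `y₀ ∈ H¹(ℚ, T_pW)` at `p` is AT LEAST `p^e` in
the PAIRING FORM of the crux-M ledger** (Kato Prop. 14.16 (2) `ν` / Lemma 14.18, read through local Tate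
duality at finite level): there is `k₁` such that for every level `k ≥ k₁`, every auxiliary exponent `j`,
every Poitou–Tate family `inv` at level `p^j p^k` with `∑_v inv_v = 0` on global classes and perfect local
pairings, every `μ_{p^j p^k}`-valued bilinear `Γ_ℚ`-equivariant ALTERNATING NON-DEGENERATE pairing `ε` on
`W[p^j p^k]` (a Weil pairing), and every integer `c`: if the class
`f_k(c · y₀) := loc_p (desc_ε^♭)_* ι′_* red_{p^k}(c · y₀) ∈ H¹(ℚ_p, W[p^k]^D)` — reduction `reduceH1Pk` modulo
`p^k`, passage `ofTopSubgroup` to `Γ_ℚ`, level transport `ι′ = torsionInclusion`, dual map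
`pairingDualIntertwining` of the DESCENDED Weil pairing `descendHom W (p^j) (p^k) ε` (`W[p^k] → W[p^k]^D`,
`D = Hom(·, μ_{p^j p^k})`), localisation at `primePlace p` — pairs to zero under `localTatePairingZMod` with
every class of the local Kummer condition `𝓚_k = kummerSelmerStructure W (p^k) (Sum.inr (primePlace p))`,
then `p^k ∣ c · p^e`.  ONE DIRECTION of the printed equality of indices (weaker than print); under the
self-duality of `𝓚_k` it is the `→` half of `ZetaLineIndexAt`.  A `Prop`; nothing asserted.
[cite: Kato2004Asterisque, Prop. 14.16 (2) (p. 244), its proof (p. 245) and Lemma 14.18 (pp. 247–248)]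
[cite: Kim2022StructureSelmer, §3.2.3 display before Thm. 3.7 (PDF p. 16)]
[cite: MilneADT2006, Ch. I, Cor. 2.3, Cor. 3.4 and §6 (proof of Prop. 6.9)] [cite: PoonenRains2012, Prop. 4.10] -/
def ZetaLineOrthIndexAt (y₀ : H1 (tateRep W p) ⊤) (e : ℕ) : Prop :=
  ∃ k₁ : ℕ, ∀ k : ℕ, k₁ ≤ k → ∀ j : ℕ,
    haveI : NeZero (p ^ j) := ⟨pow_ne_zero j (Fact.out : p.Prime).ne_zero⟩
    haveI : NeZero (p ^ k) := ⟨pow_ne_zero k (Fact.out : p.Prime).ne_zero⟩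
    haveI : Finite (geomTorsion W ((p ^ k : ℕ) : ℤ)) :=
      W.finite_torsionPoints_holds (AlgebraicClosure ℚ)
        (Int.natCast_ne_zero.mpr (pow_ne_zero k (Fact.out : p.Prime).ne_zero))
    ∀ (inv : LocalInvariants ℚ (p ^ j * p ^ k)), inv.SumLocalTermEqZero → inv.IsPerfect →
    ∀ (ε : geomTorsion W ((p ^ j * p ^ k : ℕ) : ℤ) → geomTorsion W ((p ^ j * p ^ k : ℕ) : ℤ) →
        AlgebraicClosure ℚ)
      (hμ : ∀ S T, ε S T ^ (p ^ j * p ^ k) = 1)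
      (hadd₁ : ∀ S₁ S₂ T, ε (S₁ + S₂) T = ε S₁ T * ε S₂ T)
      (hadd₂ : ∀ S T₁ T₂, ε S (T₁ + T₂) = ε S T₁ * ε S T₂)
      (hgal : ∀ (σ : absoluteGaloisGroup ℚ) (S T : geomTorsion W ((p ^ j * p ^ k : ℕ) : ℤ)),
        σ • ε S T = ε (σ • S) (σ • T)),
      (∀ T, ε T T = 1) → (∀ T, (∀ S, ε S T = 1) → T = 0) →
    ∀ c : ℤ,
      (∀ x ∈ W.kummerSelmerStructure ((p ^ k : ℕ) : ℤ) (Sum.inr (primePlace p)),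
        localTatePairingZMod (W.torsionGaloisModule ((p ^ k : ℕ) : ℤ)) (p ^ j * p ^ k)
          (Sum.inr (primePlace p)) (inv (Sum.inr (primePlace p))) x
          (galoisCohomology.localization
              ((W.torsionGaloisModule ((p ^ k : ℕ) : ℤ)).tateDual (p ^ j * p ^ k)) (Sum.inr (primePlace p)) 1
            (galoisCohomology.map (pairingDualIntertwining
                (ρ₁ := W.torsionGaloisModule ((p ^ k : ℕ) : ℤ)) (ρ₂ := W.torsionGaloisModule ((p ^ k : ℕ) : ℤ))
                (B := descendHom W (p ^ j) (p ^ k) ε hμ hadd₁ hadd₂)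
                (descendHom_smul W (p ^ j) (p ^ k) ε hμ hadd₁ hadd₂ hgal)) 1
              (galoisCohomology.map (W.torsionInclusion
                  (show ((p : ℤ) ^ k) ∣ ((p ^ k : ℕ) : ℤ) from
                    ⟨1, (Nat.cast_pow p k).trans (mul_one _).symm⟩)) 1
                ((ofTopSubgroup (W.torsionGaloisModule ((p : ℤ) ^ k)).toTopRep 1).hom
                  (reduceH1Pk W p k ⊤ (c • y₀)))))) = 0) →
      ((p ^ k : ℕ) : ℤ) ∣ c * p ^ e

end Index

end Literature.NumberTheory.EllipticCurves.Kato2004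

end
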